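import Literature.MathematicalPhysics.QuantumFieldTheory.Balaban1983to89.B2StepK
import Literature.MathematicalPhysics.QuantumFieldTheory.Balaban1983to89.B2LargeField
import Literature.MathematicalPhysics.QuantumFieldTheory.Balaban1983to89.B9SectECov

/-!
# `Balaban1983to89.B2Sect3AGaussianStep` — [Balaban1982Higgs2] §3.A pp. 585–587: the Gaussian evaluation (3.9) = (3.17)
of the k-th step integral (expansion of the block-average squares producing the configurations Φ′, Φ″ (3.13)–(3.14)), the
«rough estimates» (3.15) ⇒ (3.16), and the p. 586 sentence *"for Lᵏε sufficiently small, the operators G′_k − H′_k and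
G″_k − H″_k are positive and satisfy the inequalities (3.11) with ½γ₁ instead of γ₁"* — PROVED (theorems only)

statement-level skeleton of published theorems with citation tags; proofs where landed; nothing here is a claim about the Yang–Mills mass gap

CITATION HEADER.  T. Bałaban, *(Higgs)₂,₃ quantum fields in a finite volume. II. An upper bound*, Commun. Math. Phys.
**86** (1982) 555–594 [Balaban1982Higgs2] (cell paper B2; PDF held `paper:balaban1982-cmp86-higgs23-ii`, journal page =
PDF page + 554; pp. 584–587 READ AS IMAGES on the ×2 renders
`run/shared/lean/pub/pub-balaban/b2b-balaban-ref1/pages/1982-cmp86-higgs23-II/1982-cmp86-higgs23-II-p030…p033-x2.png`).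
Unit `lit-balaban-p15` gen 2 (Phase-2 proof seat p15; HOME `run/shared/lean/pub/lit-balaban/`).  SKELETON rows **B2.Eq3.20**
(members (3.13)–(3.17); the members (3.18) and (3.19)–(3.20) are p04's `…B1Eq346DetFactorization.eq318` and
`…B2Ineq2103LogDet`, NOT restated here) and **B2.Eq3.11** (the p. 586 consequence of (3.11)–(3.12); the «≦ O(1)(Lᵏε)^κ for
every κ» clause of (3.12) is r14's `B2StepK.RDecayBeatsPowers`/`rDecayBeatsPowers`, consumed BY NAME).  Fold owners r02 / r14,
§3 second reader r13, referee ref-4.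

WHAT IS PRINTED (verbatim — in the display (3.9) the localization subscripts of the operators `Δ⁽ᵏ⁾`, not legible at the
render resolution, are abbreviated `Δ⁽ᵏ⁾`/`Δ⁽ᵏ⁾(…)`; p. 585 [PDF 31], after the display (3.9) of the integral
`∫dA_k↾_{Λ₅⁽ᵏ⁾}∫dφ_k↾_{Λ₅⁽ᵏ⁾} exp[−½Σ_{l=k+1}^{K} a_{l−k}(L^{l−k})^{d−2} Σ_{x_l∈Λ₅⁽ˡ⁻¹⁾′∩Λ₅⁽ˡ⁾ᶜ} |A_l(x_l) − (Q_{l−k}A_k)(x_l)|²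
− ½Σ_{l} a_{l−k}(L^{l−k})^{d−2} Σ_{x_l} |φ_l(x_l) − (Q_{l−k}(Ã⁽ᵏ⁺¹⁾)φ_k)(x_l)|² − ½⟨Λ₅⁽ᵏ⁾A_k, Δ⁽ᵏ⁾Λ₅⁽ᵏ⁾A_k⟩ − ½⟨Λ₅⁽ᵏ⁾φ_k, Δ⁽ᵏ⁾(…)Λ₅⁽ᵏ⁾φ_k⟩
− ⟨(Λ₅⁽ᵏ⁻¹⁾′∩Λ₅⁽ᵏ⁾ᶜ)A_k, Δ⁽ᵏ⁾Λ₅⁽ᵏ⁾A_k⟩ − ⟨(Λ₅⁽ᵏ⁻¹⁾′∩Λ₅⁽ᵏ⁾ᶜ)φ_k, Δ⁽ᵏ⁾(…)Λ₅⁽ᵏ⁾φ_k⟩ + ⟨f′_k, Λ₅⁽ᵏ⁾A_k⟩ + ⟨f″_k, Λ₅⁽ᵏ⁾φ_k⟩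
+ ½⟨Λ₅⁽ᵏ⁾A_k, H′_kΛ₅⁽ᵏ⁾A_k⟩ + ½⟨Λ₅⁽ᵏ⁾φ_k, H″_kΛ₅⁽ᵏ⁾φ_k⟩ + ⟨F′_k, Λ₅⁽ᵏ⁾A_k⟩ + ⟨F″_k, Λ₅⁽ᵏ⁾φ_k⟩]   (3.9)`):
*"They have the property |F′_k(x)|, |F″_k(x)| ≦ O(1)exp(−δ₁r(Lᵏε)). (3.10) We will estimate this integral by the same integral
without the last four terms in the exponent […]. Since (3.9) is a Gaussian integral, we can easily calculate it and estimate
the obtained expression. We need the estimates of the quadratic forms in (3.9). Let us denote the quadratic forms in A_k,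
φ_k, connected with the first four terms in the exponential under the integral (3.9), by ⟨A_k, G′_kA_k⟩, ⟨φ_k, G″_kφ_k⟩
correspondingly. […] which as a corollary gives G′_k ≧ γ₁μ₀²(Lᵏε)²I↾_{Λ₅⁽ᵏ⁾}, G″_k ≧ γ₁m²(Lᵏε)²I↾_{Λ₅⁽ᵏ⁾}. (3.11)"*
p. 586 [PDF 32]: *"The property (3.8) implies in turn the following estimates for the norms of H′_k, H″_k in L²(Λ₅⁽ᵏ⁾):
‖H′_k‖, ‖H″_k‖ ≦ O(1)exp(−δ₁r(Lᵏε)) ≦ O(1)(Lᵏε)^κ (3.12) for every κ. Hence for Lᵏε sufficiently small, the operators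
G′_k − H′_k and G″_k − H″_k are positive and satisfy the inequalities (3.11) with ½γ₁ instead of γ₁. Let us introduce some
new notations: Φ′ = Σ_{l=k+1}^{K} a_{l−k}(L^{l−k})⁻²B^{l−k}(Λ₅⁽ˡ⁻¹⁾′∩Λ₅⁽ˡ⁾ᶜ)Q*_{l−k}A_l, (3.13)
Φ″ = Σ_{l=k+1}^{K} a_{l−k}(L^{l−k})⁻²B^{l−k}(Λ₅⁽ˡ⁻¹⁾′∩Λ₅⁽ˡ⁾ᶜ)Q*_{l−k}(Ã⁽ᵏ⁺¹⁾)φ_l. (3.14) These configurations are defined on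
Λ₅⁽ᵏ⁾. Because the fields A_l, φ_l considered on the subset Λ₋₁⁽ˡ⁻¹⁾′∩Λ₅⁽ˡ⁾ᶜ of the L^{l−k}-lattice satisfy the inequalities
|A_l(x_l)| ≦ O(1)L^{−(l−k)d/2}(1/(μ₀Lᵏε))p(Lᵏε), |φ_l(x_l)| ≦ O(1)L^{−(l−k)d/4}(1/λ(Lᵏε)^{1/4})p(Lᵏε), (3.15) so we have
|Φ′(x)| ≦ O(1)(1/(μ₀Lᵏε))p(Lᵏε) ≦ O(1)(Lᵏε)⁻², |Φ″(x)| ≦ O(1)(1/λ(Lᵏε)^{1/4})p(Lᵏε) ≦ O(1)(Lᵏε)⁻² (3.16) for x ∈ Λ₅⁽ᵏ⁾.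
Of course the above estimates are very rough, especially the second. After these preliminary remarks we can estimate the
integral (3.9). At first we have
(3.9) = (2π)^{(d/2)|Λ₅⁽ᵏ⁾|}[det(G′_k − H′_k)]^{−1/2}(2π)^{(N/2)|Λ₅⁽ᵏ⁾|}[det(G″_k − H″_k)]^{−1/2}
· exp[−½Σ_{l=k+1}^{K} a_{l−k}(L^{l−k})^{d−2} Σ_{x_l∈Λ₅⁽ˡ⁻¹⁾′∩Λ₅⁽ˡ⁾ᶜ}(|A_l(x_l)|² + |φ_l(x_l)|²)
+ ½⟨(Φ′ − Λ₅⁽ᵏ⁾Δ⁽ᵏ⁾(Λ₅⁽ᵏ⁻¹⁾′∩Λ₅⁽ᵏ⁾ᶜ)A_k + f′_k + F′_k), (G′_k − H′_k)⁻¹(Φ′ − Λ₅⁽ᵏ⁾Δ⁽ᵏ⁾(Λ₅⁽ᵏ⁻¹⁾′∩Λ₅⁽ᵏ⁾ᶜ)A_k + f′_k + F′_k)⟩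
+ ½⟨(Φ″ − Λ₅⁽ᵏ⁾Δ⁽ᵏ⁾(…)(Λ₅⁽ᵏ⁻¹⁾′∩Λ₅⁽ᵏ⁾ᶜ)φ_k + f″_k + F″_k), (G″_k − H″_k)⁻¹(Φ″ − …)⟩]. (3.17)"*
((3.8) p. 584: *"|h_k(x, x′)| ≦ O(1)exp(−δ₁r(Lᵏε))exp(−δ₀|x − x′|), x, x′ ∈ Λ₆⁽ᵏ⁻¹⁾′"*, the shape `B2StepK.KernelBound2109`.)

THE MODEL (the schematic style of `…B1GaussNorm331` / `…B1Eq346DetFactorization`, cell DIVERGENCE D-b01.3: abstract finite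
index types, the printed operators as matrices in the integration coordinates).  ONE FIELD AT A TIME: the integration
variable `A : ι → ℝ` (↤ `A_k↾_{Λ₅⁽ᵏ⁾}` with `ι` ↤ sites × vector components, resp. `φ_k↾_{Λ₅⁽ᵏ⁾}`), Lebesgue measure; the
external block-average data of the «first term»: an index type `J` (↤ the disjoint union over `l = k+1, …, K` of the sites
`x_l ∈ Λ₅⁽ˡ⁻¹⁾′∩Λ₅⁽ˡ⁾ᶜ` × components), weights `c : J → ℝ` (↤ `a_{l−k}(L^{l−k})^{d−2}`), external values `E : J → ℝ`
(↤ `A_l(x_l)`), and the matrix `Q : Matrix J ι ℝ` of the averaging `A ↦ ((Q_{l−k}A)(x_l))_{(l,x_l)}`; the «third term»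
`Δ : Matrix ι ι ℝ` (↤ `Λ₅⁽ᵏ⁾Δ⁽ᵏ⁾Λ₅⁽ᵏ⁾`); the coupling to the fixed part of the field, `Aext : ιE → ℝ` (↤ `(Λ₅⁽ᵏ⁻¹⁾′∩Λ₅⁽ᵏ⁾ᶜ)A_k`)
through `D : Matrix ιE ι ℝ` (↤ the block `(Λ₅⁽ᵏ⁻¹⁾′∩Λ₅⁽ᵏ⁾ᶜ)Δ⁽ᵏ⁾Λ₅⁽ᵏ⁾`); the vectors `f F : ι → ℝ` (↤ `f′_k, F′_k`) and the
matrix `H` (↤ `H′_k`).  IN THESE COORDINATES: `G′_k = Qᵀ·diag(c)·Q + Δ` («the quadratic forms connected with the first four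
terms»), `Φ′ = Qᵀ(c·E)` — this IS (3.13): `(Qᵀ(c·E))(x) = Σ_{(l,x_l)} Q_{(l,x_l),x}·a_{l−k}(L^{l−k})^{d−2}A_l(x_l)` and the
matrix of `Q*_{l−k}` in coordinates where `⟨·,·⟩` on the `L^{l−k}`-lattice carries the weight `(L^{l−k})^{−d}` relative to the
unit lattice of `A_k` is `(L^{l−k})^{−d}Qᵀ`, whence the printed `a_{l−k}(L^{l−k})⁻²` (`phiPrime_apply`; carrier clause as in
`B1GaussNorm331`: lattice weights live inside the matrices) — and `−Λ₅Δ(Λ₅′∩Λ₅ᶜ)A_k = −DᵀAext`.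

WHAT THIS MODULE PROVES (kernel-checked, 0 `sorry`, standard axioms; THEOREMS ONLY — no `def`, no new `Prop` fact).
§1 `sum_mul_sq_sub_mulVec` (expansion of the squares), `exponent39_eq` (the exponent of (3.9), one field, = `−½⟨A,(G′−H′)A⟩ +
⟨Φ′ − DᵀAext + f + F, A⟩ − ½Σc·E²`), `phiPrime_apply` ((3.13)/(3.14) coordinate formula).  §2 **(3.17)**:
`integral_exp_quadratic_linear` (one Gaussian field with a source and a constant, from g13's `B9SectECov.integral_exp_source`
BY NAME), `gaussConst_eq_rpow` (`√(2π)^{n}/√det = (2π)^{n/2}det^{−1/2}`, the printed shape), `integral39_field` (one field of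
(3.9) in closed form) and **`eq317`** (both fields, the printed display, as an iterated integral; hypotheses: `G′_k − H′_k`,
`G″_k − H″_k` positive definite — the p. 586 sentence, itself PROVED in §4 from (3.11)–(3.12)).  §3 **(3.15) ⇒ (3.16)**:
`one_add_log_inv_rpow_mul_rpow_le` (`(1 + log ℓ⁻¹)ᵖℓˢ ≦ max{1, p/s}ᵖ` on `(0,1]`), `thrA_pFn_le` and `thrPhi_pFn_le` (the two
«rough» right-hand inequalities of (3.16) with explicit O(1)), `sum_levels_le` (the geometric sum over `l` giving the left-hand
inequalities of (3.16) from (3.15)), `ineq316_A` (assembled first line of (3.16)).  §4 **p. 586**: `abs_quadForm_le_of_rowSum_le`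
(Schur's test for the quadratic form), `abs_quadForm_le_of_kernelBound` ((3.8) ⇒ the L²-bound (3.12) with O(1) = C·S, S = the
row sum of `e^{−δ₀|x−x′|}`), `norm312_le_pow` ((3.12) second inequality, by `rDecayBeatsPowers`), `quadForm_sub_lower`,
`posDef_of_quadForm_lower`, `exists_scale_threshold` (the quantitative «for Lᵏε sufficiently small»: a threshold ℓ₀ depending
only on δ₁, R, r, the O(1) of (3.12) and γ₁μ₀² — NOT on k, the volume or the operators), **`sentence586_of_norm312`** (for
0 < Lᵏε ≦ ℓ₀: `G′_k − H′_k` is positive definite and `≧ ½γ₁μ₀²(Lᵏε)²I`, from (3.11) + (3.12)) and **`sentence586`** (the same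
from (3.11) + (3.8)).
HONEST SCOPE.  (i) The operators `Q_{l−k}`, `Δ⁽ᵏ⁾`, `H′_k`, the sets `Λ₅⁽ˡ⁾` and the functions `f′_k, F′_k` are NOT constructed:
they enter as matrices/vectors (the displayed computation (3.9) → (3.17) is an identity in them).  (ii) (3.11) itself
(*"a corollary"* of Proposition 3.1, §3.B) and the first inequality of (3.12) beyond Schur's test (the lattice sum
`Σ_{x′}e^{−δ₀|x−x′|} = O(1)`) are hypotheses, displayed.  (iii) (3.15) enters §3 as the hypothesis on the block values
`|(B^{l−k}Q*_{l−k}A_l)(x)| ≦ sup|A_l|`; the second («especially rough») line of (3.16) is `thrPhi_pFn_le` + the same sum.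
(iv) (3.18)–(3.20) and the p. 587 continuation are p04's files (rows as above); nothing of theirs is restated.
-/

noncomputable section

open MeasureTheory Matrix Finset Real
open scoped BigOperators Matrix

namespace Literature.MathematicalPhysics.QuantumFieldTheory.Balaban1983to89.B2Sect3AGaussianStep

/-! ## §1 The exponent of (3.9): expansion of the block-average squares; (3.13)–(3.14) -/

section Algebra

variable {ι J ιE : Type*} [Fintype ι] [Fintype J] [Fintype ιE]

/-- `⟨v, QA⟩ = ⟨Qᵀv, A⟩` (real matrices: the adjoint is the transpose). [folklore] [cite: Balaban1982Higgs2, (3.13) p.586] -/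
theorem adjointQ_dotProduct (Q : Matrix J ι ℝ) (v : J → ℝ) (A : ι → ℝ) :
    v ⬝ᵥ (Q *ᵥ A) = (Qᵀ *ᵥ v) ⬝ᵥ A := by
  rw [dotProduct_mulVec, mulVec_transpose]

/-- `⟨A, Qᵀv⟩ = ⟨QA, v⟩`. [folklore] [cite: Balaban1982Higgs2, (3.13) p.586] -/
theorem dotProduct_adjointQ (Q : Matrix J ι ℝ) (v : J → ℝ) (A : ι → ℝ) :
    A ⬝ᵥ (Qᵀ *ᵥ v) = (Q *ᵥ A) ⬝ᵥ v := by
  rw [dotProduct_comm, ← adjointQ_dotProduct, dotProduct_comm]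

omit [Fintype ι] in
/-- **(3.13)/(3.14) in coordinates**: `Φ′(x) = (Qᵀ(c·E))(x) = Σ_{(l,x_l)} Q_{(l,x_l),x}·c_{(l,x_l)}·E_{(l,x_l)}` — with
`c ↤ a_{l−k}(L^{l−k})^{d−2}`, `E ↤ A_l(x_l)` (resp. `φ_l(x_l)`), `Q_{(l,x_l),x}` ↤ the matrix element of `Q_{l−k}` (resp.
`Q_{l−k}(Ã⁽ᵏ⁺¹⁾)`) this is the printed `Σ_l a_{l−k}(L^{l−k})⁻²(B^{l−k}(Λ₅⁽ˡ⁻¹⁾′∩Λ₅⁽ˡ⁾ᶜ)Q*_{l−k}A_l)(x)` (see the module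
docstring for the lattice-weight bookkeeping `(L^{l−k})^{d−2}·(L^{l−k})^{−d} = (L^{l−k})⁻²`). [cite: Balaban1982Higgs2, (3.13)–(3.14) p.586] -/
theorem phiPrime_apply (c E : J → ℝ) (Q : Matrix J ι ℝ) (x : ι) :
    (Qᵀ *ᵥ (c * E)) x = ∑ j, Q j x * (c j * E j) := by
  simp [mulVec, dotProduct, transpose_apply]

variable [DecidableEq J]

/-- Expansion of the «first term» of (3.9): `Σ_j c_j(E_j − (QA)_j)² = Σ_j c_jE_j² − 2⟨Qᵀ(c·E), A⟩ + ⟨A, QᵀCQ·A⟩`,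
`C = diag(c)` — the constant goes to the prefactor `exp[−½ΣΣ(|A_l|² + |φ_l|²)]` of (3.17), the cross term is `⟨Φ′, A_k⟩`
(3.13), the square is part of `G′_k`. [cite: Balaban1982Higgs2, (3.9) p.585, (3.13), (3.17) p.586] -/
theorem sum_mul_sq_sub_mulVec (c E : J → ℝ) (Q : Matrix J ι ℝ) (A : ι → ℝ) :
    ∑ j, c j * (E j - (Q *ᵥ A) j) ^ 2
      = ∑ j, c j * E j ^ 2 - 2 * ((Qᵀ *ᵥ (c * E)) ⬝ᵥ A)
        + A ⬝ᵥ ((Qᵀ * (diagonal c * Q)) *ᵥ A) := by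
  have h1 : (Qᵀ *ᵥ (c * E)) ⬝ᵥ A = ∑ j, c j * E j * (Q *ᵥ A) j := by
    rw [← adjointQ_dotProduct]
    simp only [dotProduct, Pi.mul_apply]
  have h2 : A ⬝ᵥ ((Qᵀ * (diagonal c * Q)) *ᵥ A) = ∑ j, c j * (Q *ᵥ A) j ^ 2 := by
    rw [← mulVec_mulVec, dotProduct_adjointQ, ← mulVec_mulVec]
    simp only [dotProduct, mulVec_diagonal]
    exact Finset.sum_congr rfl fun j _ => by ring
  rw [h1, h2, Finset.mul_sum, ← Finset.sum_sub_distrib, ← Finset.sum_add_distrib]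
  exact Finset.sum_congr rfl fun j _ => by ring

/-- **The exponent of (3.9), one field** (`A_k↾_{Λ₅⁽ᵏ⁾}`; the `φ_k`-half is the same statement): in the coordinates of the
module docstring, `−½Σ_jc_j(E_j − (QA)_j)² − ½⟨A,ΔA⟩ − ⟨Aext, DA⟩ + ⟨f,A⟩ + ½⟨A,HA⟩ + ⟨F,A⟩
= −½⟨A,(QᵀCQ + Δ − H)A⟩ + ⟨Qᵀ(c·E) − DᵀAext + f + F, A⟩ − ½Σ_jc_jE_j²` — i.e. `−½⟨A,(G′_k − H′_k)A⟩ +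
⟨Φ′ − Λ₅Δ(Λ₅′∩Λ₅ᶜ)A_k + f′_k + F′_k, A⟩ + const`, the form integrated in (3.17). [cite: Balaban1982Higgs2, (3.9) p.585, (3.17) p.586] -/
theorem exponent39_eq (c E : J → ℝ) (Q : Matrix J ι ℝ) (Δ H : Matrix ι ι ℝ) (Aext : ιE → ℝ)
    (D : Matrix ιE ι ℝ) (f F A : ι → ℝ) :
    -(1 / 2 : ℝ) * ∑ j, c j * (E j - (Q *ᵥ A) j) ^ 2 - (1 / 2 : ℝ) * (A ⬝ᵥ (Δ *ᵥ A))
        - Aext ⬝ᵥ (D *ᵥ A) + f ⬝ᵥ A + (1 / 2 : ℝ) * (A ⬝ᵥ (H *ᵥ A)) + F ⬝ᵥ A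
      = -(1 / 2 : ℝ) * (A ⬝ᵥ ((Qᵀ * (diagonal c * Q) + Δ - H) *ᵥ A))
        + (Qᵀ *ᵥ (c * E) - Dᵀ *ᵥ Aext + f + F) ⬝ᵥ A + -(1 / 2 : ℝ) * ∑ j, c j * E j ^ 2 := by
  rw [sum_mul_sq_sub_mulVec, adjointQ_dotProduct D Aext A]
  simp only [add_mulVec, sub_mulVec, dotProduct_add, dotProduct_sub, add_dotProduct, sub_dotProduct]
  ring

end Algebra

/-! ## §2 (3.17): the Gaussian evaluation -/

section Gaussian

variable {ι : Type*} [Fintype ι] [DecidableEq ι]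

/-- **One Gaussian field with a source and a constant** (the tree's generating-function theorem
`B9SectECov.integral_exp_source`, consumed by name): for `G` positive definite,
`∫dA exp(−½⟨A,GA⟩ + ⟨w,A⟩ + κ) = √(2π)^{|ι|}/√(det G) · exp(κ + ½⟨w,G⁻¹w⟩)`. [folklore] [cite: Balaban1982Higgs2, (3.17) p.586] -/
theorem integral_exp_quadratic_linear {G : Matrix ι ι ℝ} (hG : G.PosDef) (w : ι → ℝ) (κ : ℝ) :
    ∫ A : ι → ℝ, Real.exp (-(1 / 2 : ℝ) * (A ⬝ᵥ G *ᵥ A) + w ⬝ᵥ A + κ)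
      = Real.sqrt (2 * π) ^ Fintype.card ι / Real.sqrt G.det
          * Real.exp (κ + (1 / 2 : ℝ) * (w ⬝ᵥ G⁻¹ *ᵥ w)) := by
  have h := B9SectECov.integral_exp_source G hG w
  have e : ∀ A : ι → ℝ, Real.exp (-(1 / 2 : ℝ) * (A ⬝ᵥ G *ᵥ A) + w ⬝ᵥ A + κ)
      = Real.exp (-(1 / 2 : ℝ) * (A ⬝ᵥ G *ᵥ A) + w ⬝ᵥ A) * Real.exp κ := fun A => Real.exp_add _ _
  simp_rw [e]
  rw [integral_mul_const, h, Real.exp_add]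
  ring

/-- The printed shape of the Gaussian constant: `√(2π)^{n}/√(det G) = (2π)^{n/2}[det G]^{−1/2}` (`det G > 0`).
[folklore] [cite: Balaban1982Higgs2, (3.17) p.586] -/
theorem gaussConst_eq_rpow {G : Matrix ι ι ℝ} (hG : G.PosDef) :
    Real.sqrt (2 * π) ^ Fintype.card ι / Real.sqrt G.det
      = (2 * π) ^ ((Fintype.card ι : ℝ) / 2) * G.det ^ (-(1 / 2 : ℝ)) := by
  have h2π : (0 : ℝ) ≤ 2 * π := by positivity
  rw [Real.sqrt_eq_rpow, Real.sqrt_eq_rpow, ← Real.rpow_natCast, ← Real.rpow_mul h2π,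
    Real.rpow_neg hG.posSemidef.det_nonneg, div_eq_mul_inv]
  congr 2
  ring

variable {J ιE : Type*} [Fintype J] [Fintype ιE] [DecidableEq J]

/-- **One field of (3.9) in closed form**: with `G₁ := QᵀCQ + Δ − H` (↤ `G′_k − H′_k`) positive definite and
`w := Qᵀ(c·E) − DᵀAext + f + F` (↤ `Φ′ − Λ₅Δ(Λ₅′∩Λ₅ᶜ)A_k + f′_k + F′_k`),
`∫dA exp[(3.9)-exponent] = √(2π)^{|ι|}/√det G₁ · exp(−½Σc·E² + ½⟨w, G₁⁻¹w⟩)`. [cite: Balaban1982Higgs2, (3.9) p.585, (3.17) p.586] -/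
theorem integral39_field (c E : J → ℝ) (Q : Matrix J ι ℝ) (Δ H : Matrix ι ι ℝ) (Aext : ιE → ℝ)
    (D : Matrix ιE ι ℝ) (f F : ι → ℝ) (hG : (Qᵀ * (diagonal c * Q) + Δ - H).PosDef) :
    ∫ A : ι → ℝ, Real.exp (-(1 / 2 : ℝ) * ∑ j, c j * (E j - (Q *ᵥ A) j) ^ 2 - (1 / 2 : ℝ) * (A ⬝ᵥ (Δ *ᵥ A))
        - Aext ⬝ᵥ (D *ᵥ A) + f ⬝ᵥ A + (1 / 2 : ℝ) * (A ⬝ᵥ (H *ᵥ A)) + F ⬝ᵥ A)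
      = Real.sqrt (2 * π) ^ Fintype.card ι / Real.sqrt (Qᵀ * (diagonal c * Q) + Δ - H).det
          * Real.exp (-(1 / 2 : ℝ) * ∑ j, c j * E j ^ 2
              + (1 / 2 : ℝ) * ((Qᵀ *ᵥ (c * E) - Dᵀ *ᵥ Aext + f + F)
                  ⬝ᵥ (Qᵀ * (diagonal c * Q) + Δ - H)⁻¹ *ᵥ (Qᵀ *ᵥ (c * E) - Dᵀ *ᵥ Aext + f + F))) := by
  simp_rw [exponent39_eq]
  exact integral_exp_quadratic_linear hG _ _

/-- **(3.17)** p. 586 — the printed display, both fields, as the iterated integral `∫dA_k↾∫dφ_k↾` of (3.9) (index types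
`ιA` ↤ `Λ₅⁽ᵏ⁾ ×` vector components, `ιφ` ↤ `Λ₅⁽ᵏ⁾ ×` the N scalar components; subscript 1 = the `A`-objects `G′_k, H′_k,
Φ′, f′_k, F′_k`, subscript 2 = the `φ`-objects):
`(3.9) = (2π)^{|ιA|/2}[det(G′_k − H′_k)]^{−1/2}(2π)^{|ιφ|/2}[det(G″_k − H″_k)]^{−1/2} · exp[−½Σc₁E₁² − ½Σc₂E₂²
+ ½⟨w₁,(G′_k − H′_k)⁻¹w₁⟩ + ½⟨w₂,(G″_k − H″_k)⁻¹w₂⟩]`, `w₁ = Φ′ − Λ₅Δ(Λ₅′∩Λ₅ᶜ)A_k + f′_k + F′_k` etc.  Hypotheses: the two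
operators `G′_k − H′_k`, `G″_k − H″_k` are positive definite (p. 586 sentence, §4). [cite: Balaban1982Higgs2, (3.17) p.586] -/
theorem eq317 {ιA ιφ JA Jφ ιEA ιEφ : Type*} [Fintype ιA] [Fintype ιφ] [Fintype JA] [Fintype Jφ] [Fintype ιEA]
    [Fintype ιEφ] [DecidableEq ιA] [DecidableEq ιφ] [DecidableEq JA] [DecidableEq Jφ]
    (c₁ E₁ : JA → ℝ) (Q₁ : Matrix JA ιA ℝ) (Δ₁ H₁ : Matrix ιA ιA ℝ) (Aext : ιEA → ℝ) (D₁ : Matrix ιEA ιA ℝ)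
    (f₁ F₁ : ιA → ℝ)
    (c₂ E₂ : Jφ → ℝ) (Q₂ : Matrix Jφ ιφ ℝ) (Δ₂ H₂ : Matrix ιφ ιφ ℝ) (φext : ιEφ → ℝ) (D₂ : Matrix ιEφ ιφ ℝ)
    (f₂ F₂ : ιφ → ℝ)
    (h₁ : (Q₁ᵀ * (diagonal c₁ * Q₁) + Δ₁ - H₁).PosDef) (h₂ : (Q₂ᵀ * (diagonal c₂ * Q₂) + Δ₂ - H₂).PosDef) :
    ∫ A : ιA → ℝ, ∫ φ : ιφ → ℝ, Real.exp (
        -(1 / 2 : ℝ) * ∑ j, c₁ j * (E₁ j - (Q₁ *ᵥ A) j) ^ 2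
        - (1 / 2 : ℝ) * ∑ j, c₂ j * (E₂ j - (Q₂ *ᵥ φ) j) ^ 2
        - (1 / 2 : ℝ) * (A ⬝ᵥ (Δ₁ *ᵥ A)) - (1 / 2 : ℝ) * (φ ⬝ᵥ (Δ₂ *ᵥ φ))
        - Aext ⬝ᵥ (D₁ *ᵥ A) - φext ⬝ᵥ (D₂ *ᵥ φ)
        + f₁ ⬝ᵥ A + f₂ ⬝ᵥ φ
        + (1 / 2 : ℝ) * (A ⬝ᵥ (H₁ *ᵥ A)) + (1 / 2 : ℝ) * (φ ⬝ᵥ (H₂ *ᵥ φ))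
        + F₁ ⬝ᵥ A + F₂ ⬝ᵥ φ)
      = (2 * π) ^ ((Fintype.card ιA : ℝ) / 2) * (Q₁ᵀ * (diagonal c₁ * Q₁) + Δ₁ - H₁).det ^ (-(1 / 2 : ℝ))
        * ((2 * π) ^ ((Fintype.card ιφ : ℝ) / 2) * (Q₂ᵀ * (diagonal c₂ * Q₂) + Δ₂ - H₂).det ^ (-(1 / 2 : ℝ)))
        * Real.exp (-(1 / 2 : ℝ) * ∑ j, c₁ j * E₁ j ^ 2 - (1 / 2 : ℝ) * ∑ j, c₂ j * E₂ j ^ 2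
            + (1 / 2 : ℝ) * ((Q₁ᵀ *ᵥ (c₁ * E₁) - D₁ᵀ *ᵥ Aext + f₁ + F₁)
                ⬝ᵥ (Q₁ᵀ * (diagonal c₁ * Q₁) + Δ₁ - H₁)⁻¹ *ᵥ (Q₁ᵀ *ᵥ (c₁ * E₁) - D₁ᵀ *ᵥ Aext + f₁ + F₁))
            + (1 / 2 : ℝ) * ((Q₂ᵀ *ᵥ (c₂ * E₂) - D₂ᵀ *ᵥ φext + f₂ + F₂)
                ⬝ᵥ (Q₂ᵀ * (diagonal c₂ * Q₂) + Δ₂ - H₂)⁻¹ *ᵥ (Q₂ᵀ *ᵥ (c₂ * E₂) - D₂ᵀ *ᵥ φext + f₂ + F₂))) := by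
  -- split the exponent field by field and integrate φ first, then A
  have key : ∀ A : ιA → ℝ,
      (∫ φ : ιφ → ℝ, Real.exp (
        -(1 / 2 : ℝ) * ∑ j, c₁ j * (E₁ j - (Q₁ *ᵥ A) j) ^ 2
        - (1 / 2 : ℝ) * ∑ j, c₂ j * (E₂ j - (Q₂ *ᵥ φ) j) ^ 2
        - (1 / 2 : ℝ) * (A ⬝ᵥ (Δ₁ *ᵥ A)) - (1 / 2 : ℝ) * (φ ⬝ᵥ (Δ₂ *ᵥ φ))
        - Aext ⬝ᵥ (D₁ *ᵥ A) - φext ⬝ᵥ (D₂ *ᵥ φ)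
        + f₁ ⬝ᵥ A + f₂ ⬝ᵥ φ
        + (1 / 2 : ℝ) * (A ⬝ᵥ (H₁ *ᵥ A)) + (1 / 2 : ℝ) * (φ ⬝ᵥ (H₂ *ᵥ φ))
        + F₁ ⬝ᵥ A + F₂ ⬝ᵥ φ))
      = Real.exp (-(1 / 2 : ℝ) * ∑ j, c₁ j * (E₁ j - (Q₁ *ᵥ A) j) ^ 2 - (1 / 2 : ℝ) * (A ⬝ᵥ (Δ₁ *ᵥ A))
          - Aext ⬝ᵥ (D₁ *ᵥ A) + f₁ ⬝ᵥ A + (1 / 2 : ℝ) * (A ⬝ᵥ (H₁ *ᵥ A)) + F₁ ⬝ᵥ A)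
        * (Real.sqrt (2 * π) ^ Fintype.card ιφ / Real.sqrt (Q₂ᵀ * (diagonal c₂ * Q₂) + Δ₂ - H₂).det
          * Real.exp (-(1 / 2 : ℝ) * ∑ j, c₂ j * E₂ j ^ 2
              + (1 / 2 : ℝ) * ((Q₂ᵀ *ᵥ (c₂ * E₂) - D₂ᵀ *ᵥ φext + f₂ + F₂)
                  ⬝ᵥ (Q₂ᵀ * (diagonal c₂ * Q₂) + Δ₂ - H₂)⁻¹ *ᵥ (Q₂ᵀ *ᵥ (c₂ * E₂) - D₂ᵀ *ᵥ φext + f₂ + F₂)))) := by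
    intro A
    rw [← integral39_field c₂ E₂ Q₂ Δ₂ H₂ φext D₂ f₂ F₂ h₂, ← integral_const_mul]
    refine integral_congr_ae (Filter.Eventually.of_forall fun φ => ?_)
    dsimp only
    rw [← Real.exp_add]
    congr 1
    ring
  simp_rw [key]
  rw [integral_mul_const, integral39_field c₁ E₁ Q₁ Δ₁ H₁ Aext D₁ f₁ F₁ h₁, gaussConst_eq_rpow h₁,
    gaussConst_eq_rpow h₂]
  have hexp : ∀ a b u v : ℝ, Real.exp (a + u) * (Real.exp (b + v)) = Real.exp (a + b + u + v) := by
    intro a b u v; rw [← Real.exp_add]; ring_nf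
  rw [mul_mul_mul_comm, hexp]
  ring_nf

end Gaussian

/-! ## §3 (3.15) ⇒ (3.16): the rough bounds on Φ′, Φ″ -/

section Rough

/-- A logarithm grows slower than any power: for `p, s > 0` and `0 < ℓ ≦ 1`,
`(1 + log ℓ⁻¹)ᵖ · ℓˢ ≦ max{1, p/s}ᵖ` (with `t = log ℓ⁻¹ ≥ 0` and `c = min{1, s/p}`: `1 + t ≦ e^{ct}/c`).
[folklore] [cite: Balaban1982Higgs2, (3.16) p.586] -/
theorem one_add_log_inv_rpow_mul_rpow_le {p s : ℝ} (hp : 0 < p) (hs : 0 < s) {ℓ : ℝ} (hℓ : 0 < ℓ)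
    (hℓ1 : ℓ ≤ 1) : (1 + Real.log ℓ⁻¹) ^ p * ℓ ^ s ≤ (max 1 (p / s)) ^ p := by
  set t : ℝ := Real.log ℓ⁻¹ with ht
  have ht0 : 0 ≤ t := by
    rw [ht, Real.log_inv]
    have := Real.log_nonpos hℓ.le hℓ1
    linarith
  set c : ℝ := min 1 (s / p) with hc
  have hc0 : 0 < c := lt_min one_pos (div_pos hs hp)
  have hc1 : c ≤ 1 := min_le_left _ _
  have hcs : p * c ≤ s := by
    calc p * c ≤ p * (s / p) := mul_le_mul_of_nonneg_left (min_le_right _ _) hp.le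
      _ = s := mul_div_cancel₀ _ hp.ne'
  have h1t : 0 ≤ 1 + t := by linarith
  -- 1 + t ≤ e^{ct}/c
  have h1 : 1 + t ≤ Real.exp (c * t) / c := by
    rw [le_div_iff₀ hc0]
    have := Real.add_one_le_exp (c * t)
    nlinarith [mul_nonneg hc0.le ht0]
  have h2 : (1 + t) ^ p ≤ (Real.exp (c * t) / c) ^ p := Real.rpow_le_rpow h1t h1 hp.le
  have h3 : (Real.exp (c * t) / c) ^ p = Real.exp (p * c * t) * (1 / c) ^ p := by
    rw [div_eq_mul_one_div, Real.mul_rpow (Real.exp_pos _).le (by positivity), ← Real.exp_mul]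
    ring_nf
  have h4 : ℓ ^ s = Real.exp (-(s * t)) := by
    rw [Real.rpow_def_of_pos hℓ, ht, Real.log_inv]
    ring_nf
  have h5 : Real.exp (p * c * t) * Real.exp (-(s * t)) ≤ 1 := by
    rw [← Real.exp_add, Real.exp_le_one_iff]
    nlinarith
  have hmax : 1 / c = max 1 (p / s) := by
    rcases le_total 1 (s / p) with h | h
    · have hps : p / s ≤ 1 := by rw [div_le_one hs]; rwa [one_le_div hp] at h
      rw [hc, min_eq_left h, max_eq_left hps, div_one]
    · have hps : 1 ≤ p / s := by rw [one_le_div hs]; rwa [div_le_one hp] at h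
      rw [hc, min_eq_right h, max_eq_right hps, one_div_div]
  calc (1 + t) ^ p * ℓ ^ s ≤ (Real.exp (c * t) / c) ^ p * ℓ ^ s :=
        mul_le_mul_of_nonneg_right h2 (Real.rpow_nonneg hℓ.le _)
    _ = (1 / c) ^ p * (Real.exp (p * c * t) * Real.exp (-(s * t))) := by rw [h3, h4]; ring
    _ ≤ (1 / c) ^ p * 1 := mul_le_mul_of_nonneg_left h5 (by positivity)
    _ = (max 1 (p / s)) ^ p := by rw [mul_one, hmax]

/-- **(3.16), first line, right-hand inequality**: `(1/(μ₀ℓ))p(ℓ) ≦ O(1)ℓ⁻²` on `0 < ℓ ≦ 1` (`ℓ ↤ Lᵏε`), with the explicit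
`O(1) = b₀max{1,p}ᵖ/μ₀` (`p(ℓ) = b₀(1 + log ℓ⁻¹)ᵖ` = `B2.pFn`, threshold `B2LargeField.thrA μ₀ ℓ (p(ℓ)) = p(ℓ)/(μ₀ℓ)`).
[cite: Balaban1982Higgs2, (3.16) p.586] -/
theorem thrA_pFn_le {b₀ p μ₀ : ℝ} (hb : 0 ≤ b₀) (hp : 0 < p) (hμ : 0 < μ₀) {ℓ : ℝ} (hℓ : 0 < ℓ) (hℓ1 : ℓ ≤ 1) :
    B2LargeField.thrA μ₀ ℓ (B2.pFn b₀ p ℓ) ≤ b₀ * (max 1 p) ^ p / μ₀ / ℓ ^ 2 := by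
  have key := one_add_log_inv_rpow_mul_rpow_le hp one_pos hℓ hℓ1
  rw [Real.rpow_one, div_one] at key
  rw [B2LargeField.thrA, B2.pFn, div_div, div_le_div_iff₀ (mul_pos hμ hℓ) (by positivity)]
  have h1 : 0 ≤ (1 + Real.log ℓ⁻¹) ^ p := by
    apply Real.rpow_nonneg
    have := Real.log_nonpos hℓ.le hℓ1
    rw [Real.log_inv]; linarith
  calc b₀ * (1 + Real.log ℓ⁻¹) ^ p * (μ₀ * ℓ ^ 2)
      = b₀ * μ₀ * ℓ * ((1 + Real.log ℓ⁻¹) ^ p * ℓ) := by ring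
    _ ≤ b₀ * μ₀ * ℓ * (max 1 p) ^ p := mul_le_mul_of_nonneg_left key (by positivity)
    _ = b₀ * (max 1 p) ^ p * (μ₀ * ℓ) := by ring

/-- **(3.16), second line, right-hand inequality**: `(1/λ(ℓ)^{1/4})p(ℓ) ≦ O(1)ℓ⁻²` on `0 < ℓ ≦ 1`, `λ(ℓ) = λℓ^{4−d}`
(`B2LargeField.lambdaEps`, threshold `B2LargeField.thrPhi lam ℓ d (p(ℓ)) = p(ℓ)/λ(ℓ)^{1/4}`), with the explicit
`O(1) = b₀max{1, p/s}ᵖ/λ^{1/4}`, `s = (4 + d)/4` (any `d`; the paper's d = 2, 3). [cite: Balaban1982Higgs2, (3.16) p.586] -/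
theorem thrPhi_pFn_le {b₀ p lam : ℝ} (hb : 0 ≤ b₀) (hp : 0 < p) (hlam : 0 < lam) (d : ℕ) {ℓ : ℝ} (hℓ : 0 < ℓ)
    (hℓ1 : ℓ ≤ 1) :
    B2LargeField.thrPhi lam ℓ d (B2.pFn b₀ p ℓ)
      ≤ b₀ * (max 1 (p / ((4 + d) / 4))) ^ p / lam ^ (1 / 4 : ℝ) / ℓ ^ 2 := by
  have hs : (0 : ℝ) < (4 + d) / 4 := by positivity
  have key := one_add_log_inv_rpow_mul_rpow_le hp hs hℓ hℓ1
  have hlamq : 0 < lam ^ (1 / 4 : ℝ) := Real.rpow_pos_of_pos hlam _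
  -- λ(ℓ)^{1/4} = λ^{1/4} ℓ^{(4−d)/4}
  have hroot : (B2LargeField.lambdaEps lam ℓ d) ^ (1 / 4 : ℝ) = lam ^ (1 / 4 : ℝ) * ℓ ^ (((4 : ℝ) - d) / 4) := by
    rw [B2LargeField.lambdaEps, Real.mul_rpow hlam.le (zpow_nonneg hℓ.le _), ← Real.rpow_intCast,
      ← Real.rpow_mul hℓ.le]
    congr 2
    push_cast
    ring
  have h1 : 0 ≤ (1 + Real.log ℓ⁻¹) ^ p := by
    apply Real.rpow_nonneg
    have := Real.log_nonpos hℓ.le hℓ1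
    rw [Real.log_inv]; linarith
  have hℓs : ℓ ^ 2 = ℓ ^ (((4 : ℝ) + d) / 4) * ℓ ^ (((4 : ℝ) - d) / 4) := by
    rw [← Real.rpow_add hℓ, show ((4 : ℝ) + d) / 4 + ((4 : ℝ) - d) / 4 = (2 : ℕ) by ring, Real.rpow_natCast]
  rw [B2LargeField.thrPhi, B2.pFn, hroot, div_div,
    div_le_div_iff₀ (mul_pos hlamq (Real.rpow_pos_of_pos hℓ _)) (by positivity), hℓs]
  calc b₀ * (1 + Real.log ℓ⁻¹) ^ p * (lam ^ (1 / 4 : ℝ) * (ℓ ^ (((4 : ℝ) + d) / 4) * ℓ ^ (((4 : ℝ) - d) / 4)))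
      = b₀ * (lam ^ (1 / 4 : ℝ) * ℓ ^ (((4 : ℝ) - d) / 4))
          * ((1 + Real.log ℓ⁻¹) ^ p * ℓ ^ (((4 : ℝ) + d) / 4)) := by ring
    _ ≤ b₀ * (lam ^ (1 / 4 : ℝ) * ℓ ^ (((4 : ℝ) - d) / 4)) * (max 1 (p / ((4 + d) / 4))) ^ p := by
        refine mul_le_mul_of_nonneg_left ?_ (by positivity)
        exact_mod_cast key
    _ = b₀ * (max 1 (p / ((4 + d) / 4))) ^ p * (lam ^ (1 / 4 : ℝ) * ℓ ^ (((4 : ℝ) - d) / 4)) := by ring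

/-- **(3.15) ⇒ (3.16), the sum over `l`**: if `Φ(x) = Σ_{j=1}^{m} a_j(Lʲ)⁻²u_j(x)` (`j = l − k`, `m = K − k`, `a_j ∈ [0, ā]`
the precisions `a_{l−k}`, `u_j(x)` ↤ `(B^{l−k}(…)Q*_{l−k}A_l)(x)`, a value of `A_l` on the block containing `x`) and (3.15)
`|u_j(x)| ≦ C·L^{−jd/2}·T` (`T ↤ (1/(μ₀Lᵏε))p(Lᵏε)`, resp. `L^{−jd/4}`, `T ↤ (1/λ(Lᵏε)^{1/4})p(Lᵏε)` — any exponent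
`e ≥ 0` below), then `|Φ(x)| ≦ āCT·Σ_{j≥1}L^{−2j} ≦ āCT` for `L ≧ 2` (indeed `Σ_{j≥1}L^{−2j} = 1/(L² − 1) ≦ ⅓`).
[cite: Balaban1982Higgs2, (3.15)–(3.16) p.586] -/
theorem sum_levels_le {m : ℕ} {L ā C T e : ℝ} (hL : 2 ≤ L) (hā : 0 ≤ ā) (hC : 0 ≤ C) (hT : 0 ≤ T) (he : 0 ≤ e)
    (a u : ℕ → ℝ) (ha : ∀ j, 0 ≤ a j ∧ a j ≤ ā) (hu : ∀ j, 1 ≤ j → |u j| ≤ C * L ^ (-(e * j)) * T) :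
    |∑ j ∈ Finset.Icc 1 m, a j * ((L ^ j) ^ 2)⁻¹ * u j| ≤ ā * C * T := by
  have hL0 : 0 < L := by linarith
  have hL1 : 1 ≤ L := by linarith
  set q : ℝ := (L ^ 2)⁻¹ with hq
  have hq0 : 0 ≤ q := by positivity
  have hq1 : q < 1 := by
    rw [hq]; apply inv_lt_one_of_one_lt₀; nlinarith
  have hqj : ∀ j : ℕ, ((L ^ j) ^ 2)⁻¹ = q ^ j := by
    intro j; rw [hq, ← pow_mul, inv_pow, ← pow_mul, mul_comm]
  -- each term ≤ ā C T q^j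
  have hterm : ∀ j ∈ Finset.Icc 1 m, |a j * ((L ^ j) ^ 2)⁻¹ * u j| ≤ ā * C * T * q ^ j := by
    intro j hj
    have hj1 : 1 ≤ j := (Finset.mem_Icc.mp hj).1
    have hLe : L ^ (-(e * j)) ≤ 1 := by
      apply Real.rpow_le_one_of_one_le_of_nonpos hL1
      have : (0 : ℝ) ≤ e * j := by positivity
      linarith
    have hu' : |u j| ≤ C * T := by
      calc |u j| ≤ C * L ^ (-(e * j)) * T := hu j hj1
        _ ≤ C * 1 * T := by gcongr
        _ = C * T := by ring
    rw [abs_mul, abs_mul, abs_of_nonneg (ha j).1, hqj, abs_of_nonneg (pow_nonneg hq0 _)]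
    calc a j * q ^ j * |u j| ≤ ā * q ^ j * (C * T) :=
          mul_le_mul (mul_le_mul_of_nonneg_right (ha j).2 (pow_nonneg hq0 _)) hu' (abs_nonneg _)
            (mul_nonneg hā (pow_nonneg hq0 _))
      _ = ā * C * T * q ^ j := by ring
  have hgeom : ∑ j ∈ Finset.Icc 1 m, q ^ j ≤ 1 := by
    have h := geom_sum_Ico_le_of_lt_one (m := 1) (n := m + 1) hq0 hq1
    have hIcc : Finset.Icc 1 m = Finset.Ico 1 (m + 1) := by
      ext j; simp
    rw [hIcc]
    refine h.trans ?_
    rw [pow_one, div_le_one (by linarith)]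
    -- q ≤ 1 - q since q ≤ 1/4
    have : q ≤ 1 / 4 := by
      rw [hq]
      have h4 : (4 : ℝ) ≤ L ^ 2 := by nlinarith
      calc (L ^ 2)⁻¹ ≤ (4 : ℝ)⁻¹ := by gcongr
        _ = 1 / 4 := by norm_num
    linarith
  calc |∑ j ∈ Finset.Icc 1 m, a j * ((L ^ j) ^ 2)⁻¹ * u j|
      ≤ ∑ j ∈ Finset.Icc 1 m, |a j * ((L ^ j) ^ 2)⁻¹ * u j| := Finset.abs_sum_le_sum_abs _ _
    _ ≤ ∑ j ∈ Finset.Icc 1 m, ā * C * T * q ^ j := Finset.sum_le_sum hterm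
    _ = ā * C * T * ∑ j ∈ Finset.Icc 1 m, q ^ j := by rw [Finset.mul_sum]
    _ ≤ ā * C * T * 1 := mul_le_mul_of_nonneg_left hgeom (by positivity)
    _ = ā * C * T := mul_one _

/-- **(3.16), first line, assembled**: under (3.15) for the values `u_j(x)` of `A_{k+j}` on the blocks
(`|u_j(x)| ≦ C·L^{−jd/2}·(1/(μ₀ℓ))p(ℓ)`, `ℓ = Lᵏε ∈ (0,1]`), the configuration `Φ′(x) = Σ_{j=1}^{m} a_j(Lʲ)⁻²u_j(x)` satisfies
`|Φ′(x)| ≦ āC·(1/(μ₀ℓ))p(ℓ) ≦ āC·(b₀max{1,p}ᵖ/μ₀)·ℓ⁻²`. [cite: Balaban1982Higgs2, (3.15)–(3.16) p.586] -/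
theorem ineq316_A {m : ℕ} {L ā C b₀ p μ₀ ℓ : ℝ} {d : ℕ} (hL : 2 ≤ L) (hā : 0 ≤ ā) (hC : 0 ≤ C) (hb : 0 ≤ b₀)
    (hp : 0 < p) (hμ : 0 < μ₀) (hℓ : 0 < ℓ) (hℓ1 : ℓ ≤ 1) (a u : ℕ → ℝ) (ha : ∀ j, 0 ≤ a j ∧ a j ≤ ā)
    (hu : ∀ j, 1 ≤ j → |u j| ≤ C * L ^ (-((d : ℝ) / 2 * j)) * B2LargeField.thrA μ₀ ℓ (B2.pFn b₀ p ℓ)) :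
    |∑ j ∈ Finset.Icc 1 m, a j * ((L ^ j) ^ 2)⁻¹ * u j| ≤ ā * C * B2LargeField.thrA μ₀ ℓ (B2.pFn b₀ p ℓ)
      ∧ ā * C * B2LargeField.thrA μ₀ ℓ (B2.pFn b₀ p ℓ) ≤ ā * C * (b₀ * (max 1 p) ^ p / μ₀ / ℓ ^ 2) := by
  have hT : 0 ≤ B2LargeField.thrA μ₀ ℓ (B2.pFn b₀ p ℓ) := by
    rw [B2LargeField.thrA, B2.pFn]
    apply div_nonneg _ (by positivity)
    apply mul_nonneg hb
    apply Real.rpow_nonneg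
    have := Real.log_nonpos hℓ.le hℓ1
    rw [Real.log_inv]; linarith
  refine ⟨sum_levels_le hL hā hC hT (by positivity : (0 : ℝ) ≤ (d : ℝ) / 2) a u ha hu, ?_⟩
  exact mul_le_mul_of_nonneg_left (thrA_pFn_le hb hp hμ hℓ hℓ1) (by positivity)

end Rough

/-! ## §4 p. 586: (3.11) and (3.12) ⇒ `G′_k − H′_k`, `G″_k − H″_k` positive, `≧ ½γ₁μ₀²(Lᵏε)²I` -/

section Positivity

-- `X : Type` (universe 0) to match r14's `B2StepK.KernelBound2109 {X : Type}`.
variable {X : Type} [Fintype X]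

/-- **Schur's test for a quadratic form** (the mechanism behind *"(3.8) implies … the estimates for the norms of H′_k,
H″_k in L²(Λ₅⁽ᵏ⁾)"*): if every row sum and every column sum of `|h(x,x′)|` is `≦ B`, then `|⟨u,Hu⟩| ≦ B‖u‖²`.
[folklore] [cite: Balaban1982Higgs2, (3.12) p.586] -/
theorem abs_quadForm_le_of_rowSum_le (H : Matrix X X ℝ) {B : ℝ} (hrow : ∀ x, ∑ x', |H x x'| ≤ B)
    (hcol : ∀ x', ∑ x, |H x x'| ≤ B) (u : X → ℝ) : |u ⬝ᵥ (H *ᵥ u)| ≤ B * (u ⬝ᵥ u) := by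
  have hexp : u ⬝ᵥ (H *ᵥ u) = ∑ x, ∑ x', u x * H x x' * u x' := by
    simp only [dotProduct, mulVec, Finset.mul_sum]
    exact Finset.sum_congr rfl fun x _ => Finset.sum_congr rfl fun x' _ => by ring
  have huu : u ⬝ᵥ u = ∑ x, u x ^ 2 := by
    simp only [dotProduct, pow_two]
  rw [hexp, huu]
  calc |∑ x, ∑ x', u x * H x x' * u x'|
      ≤ ∑ x, ∑ x', |H x x'| * ((u x ^ 2 + u x' ^ 2) / 2) := by
        refine (Finset.abs_sum_le_sum_abs _ _).trans (Finset.sum_le_sum fun x _ => ?_)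
        refine (Finset.abs_sum_le_sum_abs _ _).trans (Finset.sum_le_sum fun x' _ => ?_)
        rw [abs_mul, abs_mul]
        have h2 := two_mul_le_add_sq (|u x|) (|u x'|)
        rw [sq_abs, sq_abs] at h2
        calc |u x| * |H x x'| * |u x'| = |H x x'| * (|u x| * |u x'|) := by ring
          _ ≤ |H x x'| * ((u x ^ 2 + u x' ^ 2) / 2) :=
              mul_le_mul_of_nonneg_left (by linarith) (abs_nonneg _)
    _ = (∑ x, ∑ x', u x ^ 2 / 2 * |H x x'|) + ∑ x, ∑ x', u x' ^ 2 / 2 * |H x x'| := by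
        rw [← Finset.sum_add_distrib]
        refine Finset.sum_congr rfl fun x _ => ?_
        rw [← Finset.sum_add_distrib]
        exact Finset.sum_congr rfl fun x' _ => by ring
    _ = (∑ x, u x ^ 2 / 2 * ∑ x', |H x x'|) + ∑ x', u x' ^ 2 / 2 * ∑ x, |H x x'| := by
        congr 1
        · simp_rw [Finset.mul_sum]
        · rw [Finset.sum_comm]
          simp_rw [Finset.mul_sum]
    _ ≤ (∑ x, u x ^ 2 / 2 * B) + ∑ x', u x' ^ 2 / 2 * B := by
        gcongr with x _ x' _
        · exact hrow x
        · exact hcol x'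
    _ = B * ∑ x, u x ^ 2 := by rw [← Finset.sum_mul, ← Finset.sum_div]; ring

/-- **(3.8) ⇒ (3.12), quadratic-form version**: a kernel bound `|h(x,x′)| ≦ Ce^{−δ₁r}e^{−δ₀|x−x′|}` (the predicate
`B2StepK.KernelBound2109` of (2.109)/(3.8)) with a symmetric distance and lattice row sums `Σ_{x′}e^{−δ₀|x−x′|} ≦ S` gives
`|⟨u,Hu⟩| ≦ C·S·e^{−δ₁r}·‖u‖²` — the printed `‖H′_k‖ ≦ O(1)exp(−δ₁r(Lᵏε))` with `O(1) = C·S`.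
[cite: Balaban1982Higgs2, (3.8) p.584, (3.12) p.586] -/
theorem abs_quadForm_le_of_kernelBound (H : Matrix X X ℝ) {dist : X → X → ℝ} {C δ₁ δ₀ r S : ℝ} (hC : 0 ≤ C)
    (hk : B2StepK.KernelBound2109 (fun x x' => H x x') dist C δ₁ δ₀ r) (hsymm : ∀ x x', dist x x' = dist x' x)
    (hS : ∀ x, ∑ x', Real.exp (-(δ₀ * dist x x')) ≤ S) (u : X → ℝ) :
    |u ⬝ᵥ (H *ᵥ u)| ≤ C * S * Real.exp (-(δ₁ * r)) * (u ⬝ᵥ u) := by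
  have hCe : 0 ≤ C * Real.exp (-(δ₁ * r)) := mul_nonneg hC (Real.exp_pos _).le
  have hrow : ∀ x, ∑ x', |H x x'| ≤ C * S * Real.exp (-(δ₁ * r)) := by
    intro x
    calc ∑ x', |H x x'| ≤ ∑ x', C * Real.exp (-(δ₁ * r)) * Real.exp (-(δ₀ * dist x x')) :=
          Finset.sum_le_sum fun x' _ => hk x x'
      _ = C * Real.exp (-(δ₁ * r)) * ∑ x', Real.exp (-(δ₀ * dist x x')) := by rw [Finset.mul_sum]
      _ ≤ C * Real.exp (-(δ₁ * r)) * S := mul_le_mul_of_nonneg_left (hS x) hCe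
      _ = C * S * Real.exp (-(δ₁ * r)) := by ring
  have hcol : ∀ x', ∑ x, |H x x'| ≤ C * S * Real.exp (-(δ₁ * r)) := by
    intro x'
    calc ∑ x, |H x x'| ≤ ∑ x, C * Real.exp (-(δ₁ * r)) * Real.exp (-(δ₀ * dist x x')) :=
          Finset.sum_le_sum fun x _ => hk x x'
      _ = C * Real.exp (-(δ₁ * r)) * ∑ x, Real.exp (-(δ₀ * dist x' x)) := by
          rw [Finset.mul_sum]; simp_rw [hsymm _ x']
      _ ≤ C * Real.exp (-(δ₁ * r)) * S := mul_le_mul_of_nonneg_left (hS x') hCe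
      _ = C * S * Real.exp (-(δ₁ * r)) := by ring
  exact abs_quadForm_le_of_rowSum_le H hrow hcol u

/-- **(3.12), second inequality** (*"≦ O(1)(Lᵏε)^κ for every κ"*): with `r = r(ℓ) = R(1 + log ℓ⁻¹)ʳ` (`B2.rFn`, r > 1,
R > 0, δ₁ > 0 — r14's `B2StepK.rDecayBeatsPowers`), for every κ there is `C_κ` with `C·S·e^{−δ₁r(ℓ)} ≦ C·S·C_κ·ℓ^κ` on
`(0,1]`. [cite: Balaban1982Higgs2, (3.12) p.586] -/
theorem norm312_le_pow {δ₁ R r C S : ℝ} (hδ : 0 < δ₁) (hR : 0 < R) (hr : 1 < r) (hC : 0 ≤ C) (hS : 0 ≤ S) (κ : ℝ) :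
    ∃ Cκ : ℝ, ∀ ℓ : ℝ, 0 < ℓ → ℓ ≤ 1 →
      C * S * Real.exp (-(δ₁ * B2.rFn R r ℓ)) ≤ C * S * Cκ * ℓ ^ κ := by
  obtain ⟨Cκ, hCκ⟩ := B2StepK.rDecayBeatsPowers hδ hR hr κ
  refine ⟨Cκ, fun ℓ hℓ hℓ1 => ?_⟩
  have := mul_le_mul_of_nonneg_left (hCκ ℓ hℓ hℓ1) (mul_nonneg hC hS)
  simpa [mul_assoc] using this

/-- Loewner bookkeeping of the p. 586 sentence: `G ≧ gI` and `|⟨u,Hu⟩| ≦ η‖u‖²` give `G − H ≧ (g − η)I`.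
[cite: Balaban1982Higgs2, p.586] -/
theorem quadForm_sub_lower {G H : Matrix X X ℝ} {g η : ℝ} (hG : ∀ u, g * (u ⬝ᵥ u) ≤ u ⬝ᵥ (G *ᵥ u))
    (hH : ∀ u, |u ⬝ᵥ (H *ᵥ u)| ≤ η * (u ⬝ᵥ u)) (u : X → ℝ) :
    (g - η) * (u ⬝ᵥ u) ≤ u ⬝ᵥ ((G - H) *ᵥ u) := by
  have h1 := hG u
  have h2 := (abs_le.mp (hH u)).2
  rw [sub_mulVec, dotProduct_sub]
  linarith

/-- A symmetric real matrix whose form dominates `m‖u‖²` with `m > 0` is positive definite.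
[folklore] [cite: Balaban1982Higgs2, p.586] -/
theorem posDef_of_quadForm_lower {M : Matrix X X ℝ} (hM : M.IsSymm) {m : ℝ} (hm : 0 < m)
    (h : ∀ u, m * (u ⬝ᵥ u) ≤ u ⬝ᵥ (M *ᵥ u)) : M.PosDef := by
  refine PosDef.of_dotProduct_mulVec_pos ?_ fun u hu => ?_
  · rw [IsHermitian, conjTranspose_eq_transpose_of_trivial]
    exact hM.eq
  · have h0 : 0 ≤ u ⬝ᵥ u := Finset.sum_nonneg fun x _ => mul_self_nonneg (u x)
    have hne : u ⬝ᵥ u ≠ 0 := fun h0' => hu (dotProduct_self_eq_zero.mp h0')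
    have hpos : 0 < u ⬝ᵥ u := lt_of_le_of_ne h0 (Ne.symm hne)
    have := h u
    simp only [star_trivial]
    nlinarith

/-- **«for Lᵏε sufficiently small», quantitatively**: for δ₁, R > 0, r > 1 (the printed ranges of r(ε), (2.7)), an O(1)
constant `C_H ≥ 0` of (3.12) and a positivity constant `γ > 0` of (3.11) (↤ `γ₁μ₀²`, resp. `γ₁m²`) there is a threshold
`ℓ₀ ∈ (0,1]` — depending on these five numbers only — with `C_H·e^{−δ₁r(ℓ)} ≦ ½γℓ²` for all `0 < ℓ ≦ ℓ₀` (via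
`rDecayBeatsPowers` at κ = 3). [cite: Balaban1982Higgs2, (3.11)–(3.12) p.585–586] -/
theorem exists_scale_threshold {δ₁ R r : ℝ} (hδ : 0 < δ₁) (hR : 0 < R) (hr : 1 < r) {CH γ : ℝ} (hCH : 0 ≤ CH)
    (hγ : 0 < γ) :
    ∃ ℓ₀ : ℝ, 0 < ℓ₀ ∧ ℓ₀ ≤ 1 ∧ ∀ ℓ : ℝ, 0 < ℓ → ℓ ≤ ℓ₀ →
      CH * Real.exp (-(δ₁ * B2.rFn R r ℓ)) ≤ γ / 2 * ℓ ^ 2 := by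
  obtain ⟨C₃, hC₃⟩ := B2StepK.rDecayBeatsPowers hδ hR hr 3
  have hC₃pos : 0 < C₃ := by
    have h := hC₃ 1 one_pos le_rfl
    rw [Real.one_rpow, mul_one] at h
    exact (Real.exp_pos _).trans_le h
  set M : ℝ := CH * C₃ + 1 with hM
  have hM0 : 0 < M := by positivity
  refine ⟨min 1 (γ / (2 * M)), lt_min one_pos (by positivity), min_le_left _ _, fun ℓ hℓ hℓ0 => ?_⟩
  have hℓ1 : ℓ ≤ 1 := hℓ0.trans (min_le_left _ _)
  have hℓM : ℓ ≤ γ / (2 * M) := hℓ0.trans (min_le_right _ _)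
  have h1 := hC₃ ℓ hℓ hℓ1
  have h3 : ℓ ^ (3 : ℝ) = ℓ ^ 2 * ℓ := by
    rw [show (3 : ℝ) = ((3 : ℕ) : ℝ) by norm_num, Real.rpow_natCast]; ring
  calc CH * Real.exp (-(δ₁ * B2.rFn R r ℓ)) ≤ CH * (C₃ * ℓ ^ (3 : ℝ)) := mul_le_mul_of_nonneg_left h1 hCH
    _ = CH * C₃ * ℓ * ℓ ^ 2 := by rw [h3]; ring
    _ ≤ M * (γ / (2 * M)) * ℓ ^ 2 := by
        refine mul_le_mul_of_nonneg_right ?_ (by positivity)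
        exact mul_le_mul (by linarith) hℓM hℓ.le hM0.le
    _ = γ / 2 * ℓ ^ 2 := by field_simp

/-- **The p. 586 sentence, PROVED** (from (3.11) and the L²-bound (3.12)): *"Hence for Lᵏε sufficiently small, the
operators G′_k − H′_k and G″_k − H″_k are positive and satisfy the inequalities (3.11) with ½γ₁ instead of γ₁."*
Precisely: for the printed ranges δ₁, R > 0, r > 1 of r(ε) ((2.7)), an O(1) `C_H ≥ 0` of (3.12) and the constant `γ > 0` of
(3.11) (↤ `γ₁μ₀²` for `G′_k`, `γ₁m²` for `G″_k`) there is `ℓ₀ > 0` such that for every scale `0 < ℓ = Lᵏε ≦ ℓ₀`, every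
finite index set (↤ `Λ₅⁽ᵏ⁾ ×` components) and all symmetric `G`, `H` on it with (3.11) `G ≧ γℓ²I` and (3.12)
`|⟨u,Hu⟩| ≦ C_He^{−δ₁r(ℓ)}‖u‖²`: `G − H` is positive definite and `G − H ≧ ½γℓ²I`.  The threshold depends on
δ₁, R, r, C_H, γ only — not on k, on the volume, or on the operators. [cite: Balaban1982Higgs2, p.586; (3.11) p.585; (3.12) p.586] -/
theorem sentence586_of_norm312 {δ₁ R r : ℝ} (hδ : 0 < δ₁) (hR : 0 < R) (hr : 1 < r) {CH γ : ℝ} (hCH : 0 ≤ CH)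
    (hγ : 0 < γ) :
    ∃ ℓ₀ : ℝ, 0 < ℓ₀ ∧ ∀ ℓ : ℝ, 0 < ℓ → ℓ ≤ ℓ₀ →
      ∀ {Y : Type} [Fintype Y] (G H : Matrix Y Y ℝ), G.IsSymm → H.IsSymm →
        (∀ u, γ * ℓ ^ 2 * (u ⬝ᵥ u) ≤ u ⬝ᵥ (G *ᵥ u)) →
        (∀ u, |u ⬝ᵥ (H *ᵥ u)| ≤ CH * Real.exp (-(δ₁ * B2.rFn R r ℓ)) * (u ⬝ᵥ u)) →
        (G - H).PosDef ∧ ∀ u, γ / 2 * ℓ ^ 2 * (u ⬝ᵥ u) ≤ u ⬝ᵥ ((G - H) *ᵥ u) := by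
  obtain ⟨ℓ₀, hℓ₀, -, hthr⟩ := exists_scale_threshold hδ hR hr hCH hγ
  refine ⟨ℓ₀, hℓ₀, fun ℓ hℓ hℓ0 Y _ G H hGs hHs hG hH => ?_⟩
  have hsmall : CH * Real.exp (-(δ₁ * B2.rFn R r ℓ)) ≤ γ / 2 * ℓ ^ 2 := hthr ℓ hℓ hℓ0
  have hlow : ∀ u : Y → ℝ, γ / 2 * ℓ ^ 2 * (u ⬝ᵥ u) ≤ u ⬝ᵥ ((G - H) *ᵥ u) := by
    intro u
    have h1 := quadForm_sub_lower hG hH u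
    have h0 : 0 ≤ u ⬝ᵥ u := Finset.sum_nonneg fun x _ => mul_self_nonneg (u x)
    nlinarith
  exact ⟨posDef_of_quadForm_lower (hGs.sub hHs) (by positivity) hlow, hlow⟩

/-- **The p. 586 sentence from (3.8)** (the printed chain (3.8) ⇒ (3.12) ⇒ positivity): as `sentence586_of_norm312`, with
(3.12) replaced by its source — the kernel bound (3.8) `|h(x,x′)| ≦ Ce^{−δ₁r(ℓ)}e^{−δ₀|x−x′|}` for the kernel of `H`
(`B2StepK.KernelBound2109`, symmetric distance) and a volume-independent bound `S` for the lattice sums `Σ_{x′}e^{−δ₀|x−x′|}`;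
the O(1) of (3.12) is then `C·S` (`abs_quadForm_le_of_kernelBound`). [cite: Balaban1982Higgs2, p.586; (3.8) p.584; (3.11) p.585; (3.12) p.586] -/
theorem sentence586 {δ₁ R r : ℝ} (hδ : 0 < δ₁) (hR : 0 < R) (hr : 1 < r) {C S γ : ℝ} (hC : 0 ≤ C) (hS : 0 ≤ S)
    (hγ : 0 < γ) :
    ∃ ℓ₀ : ℝ, 0 < ℓ₀ ∧ ∀ ℓ : ℝ, 0 < ℓ → ℓ ≤ ℓ₀ →
      ∀ {Y : Type} [Fintype Y] (G H : Matrix Y Y ℝ) (dist : Y → Y → ℝ) (δ₀ : ℝ),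
        G.IsSymm → H.IsSymm →
        (∀ u, γ * ℓ ^ 2 * (u ⬝ᵥ u) ≤ u ⬝ᵥ (G *ᵥ u)) →
        B2StepK.KernelBound2109 (fun x x' => H x x') dist C δ₁ δ₀ (B2.rFn R r ℓ) →
        (∀ x x', dist x x' = dist x' x) → (∀ x, ∑ x', Real.exp (-(δ₀ * dist x x')) ≤ S) →
        (G - H).PosDef ∧ ∀ u, γ / 2 * ℓ ^ 2 * (u ⬝ᵥ u) ≤ u ⬝ᵥ ((G - H) *ᵥ u) := by
  obtain ⟨ℓ₀, hℓ₀, h⟩ := sentence586_of_norm312 hδ hR hr (mul_nonneg hC hS) hγ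
  refine ⟨ℓ₀, hℓ₀, fun ℓ hℓ hℓ0 Y _ G H dist δ₀ hGs hHs hG hk hsymm hSum => ?_⟩
  exact h ℓ hℓ hℓ0 G H hGs hHs hG (abs_quadForm_le_of_kernelBound H hC hk hsymm hSum)

end Positivity

end Literature.MathematicalPhysics.QuantumFieldTheory.Balaban1983to89.B2Sect3AGaussianStep
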